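import Summits.QuantumFields.YangMills.Theorems.BalabanUVNodesN12WindowGradedLetters
import HarnessLib

/-!
# BalabanUVNodes ∕ N12 — THE WINDOW GAUGE LETTER WITH A `k`-UNIFORM TOLERANCE: the tower-axial gauge of the (2.12) minimiser along the rooted forest of record is near-flat on every fine bond of a
# window `X` near `Ω_k(Z)` with `‖↑((σ•U₀) b) − 1‖ ≤ ((4d+m′+3)²L²∕4 + 24m′·((d+2)L)²∕4)·ε + m′·ρn`, from ONE class ∕ [15]-Thm-1 letter at level `k − 1`, the region datum on the shadows near
# the window, and collar numerics — the graded edition of `…N12WindowGaugeLetterLocal` (p671561), whose tolerance grew like `(m′)²L^{2k}·ε`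

Cell `pub-ymgap` (HUMAN RULINGS D-0062 ∕ D-0149), WIDTH SEAT `pub-ymgap-dag-n12-w6` g7 (node N12 = [B15]; key K1⁹ `stmt-QuantumFields-27364`, `--kind proof --supports … --as helper`;
count-neutral).  THEOREMS ONLY (0 `def`, 0 `instance`, 0 `sorry`).  Composition BY NAME of this seat's
`…N12WindowNearRegionGeometry` ∕ `…N12WindowGradedLetters` with the skeleton of `…N12WindowGaugeLetterLocal.exists_windowGauge_of_plaqSmall`: p635000 `exists_towerForest_rooted_Bj` (the forest of
record), p622221 `toMS_holAtGauge_eq_one` ∕ `isMinimizer_gaugeAct_holAtGauge_atRecord` ∕ `dist1_gaugeAct_holAtGauge_le_of_not_mem`, w6 p640962 §3 `dist1_gaugeAct_holAtGauge_le_graded` at `Ω := X ∩ Ω₁(Z)`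
with UNIFORM budgets `ℓs := ℓ_k`, `ℓb := m′L^k` and the level-`(k−1)` plaquette letter on the Stokes boxes (`boxPlaqs_subset_plaqsOf_topSeq_pred`), dag-n12-w3's `datumLetter_of_shadows_local` ∕
`shadowLetter_of_box` ∕ `noWrap_of_levelGuard`.

WHAT.  ★★★ `exists_windowGauge_uniform` — hypotheses as p671561's free-`ε` window gauge EXCEPT: the plaquette letter is asked at level `k − 1` ONLY (`PlaqSmallOn (plaqsOf Ω_{k−1}) (ε·η_{k−1}²) U₀`),
the window carries ONE nearness row `hXΩ` (every `x ∈ X` is `walkEnd x₀ w₀`, `x₀ ∈ Ω_k(Z)`, `|w₀| ≤ D₀`) and ONE collar row `hfit : D₀ + 3ℓ_k + (m′+5)L^k + ((d+4)L+2)·Σ_{l<k}Lˡ + 4 ≤ L^{k−1}·M₁`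
(`M₁ ≳ D₀∕L^{k−1} + (6d + m′ + 10)L + (d+4)L·2` suffices), the radii rows `hMrad`∕`hM₁` are gone; conclusion: `hu`, minimiser-hood of `σ • U₀`, and on the bonds of `X`
`‖↑((σ•U₀) b) − 1‖ ≤ ((2ℓ_k+1+m′L^k)²∕4)·(ε·η_{k−1}²) + m′·24·(((d+2)L)²∕4)·ε + m′·ρn`.  ★★★ `exists_windowGauge_uniform_le` — the same with the `k`-FREE constant
`((4d+m′+3)²·L²∕4 + 24·m′·((d+2)L)²∕4)·ε + m′·ρn`.  (`ℓ_k = Σ_{i≤k}(d(Lⁱ−1)∕2+1)`, `m′ = 3·d·((L−1)∕2) + 5`, `η_j = L^{−j}`.)  The socket shapes of p658881's `hσW` follow in `…UniformSocket`.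

HONEST FRAMING.  Lattice bookkeeping and composition by name over landed kernel theorems; the minimiser ([15] Thm 1 ∕ the lane's (E)), its graded plaquette letter, the region datum, the window
rows and the numerics stay HYPOTHESES; the constants are `C(d, L)` — uniform in the level `k` and in the volume, but NOT print's `O(1)` bookkeeping of [15] (16)–(18) verbatim; nothing of
Bałaban's asserted beyond the cited tree theorems; count-neutral; N12 NOT discharged; K1⁹ NOT closed; counts unmoved (typed 28∕28 · discharged 5∕27); one finite 𝕋⁴ programme at fixed
`ε = L^{-K}` — R4 closes the conditional rung `BalabanLadder.UV` only; no summit statement is proved here and NOT the Yang–Mills mass gap (Clay); nothing continuum ∕ ℝ⁴ ∕ OS.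

References: [Balaban1985Variational] CMP 102 (1985) 277–309, (2)–(4) p.278, Thm 1 (8) p.279, (16)–(18) p.280; [Balaban1985RegularSpaces] CMP 98 (1985), (1.7) p.77, (1.19) p.79;
[Balaban1985Averaging] CMP 98 (1985) 17–51, (19)–(20) p.21, Prop. 2 (52)–(53) p.26; [Balaban1988Convergent] CMP 119 (1988) 243–285, p.255, (2.2) p.255, (2.11)–(2.13) pp.256–257, (2.16)
p.257; [Balaban1987RG1] CMP 109 (1987), (0.1) p.251; [Balaban1989LargeFieldII] CMP 122 (1989) 355–392, p.357.
-/

noncomputable section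

open scoped Matrix.Norms.L2Operator BigOperators

namespace Summit.QuantumFields.YangMills.BalabanUVNodes.N12WindowGaugeLetterUniform

open Literature.MathematicalPhysics.QuantumFieldTheory.Balaban1983to89
open T4Continuum GaugeField B15DeterminingSets BlockAveraging
open T4CubeChartGnomonic (SU2)
open B16Sect1Backgrounds (toMS)
open T4AxialGaugeSmallField (boxPlaqs castSite)
open B14.Eq213MaximalDomains (side)
open B14.Eq213DetSet (Bj maxDomT maxDomT_antitone dist_maxDomT)
open B14.Eq216Concrete (inputs)
open B14.Eq22Determines (blockIter)
open B14DomainGeom (Within Pt)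
open B15Eq112TorusCover (cover lift cover_lift cover_apply)
open B5Eq118OneStroke (iterBlockOf)
open B8Eq17ClassAkV1 (plaqsOf)
open ExpMeanLog (expMeanLogSU deltaSU)
open Literature.MathematicalPhysics.QuantumFieldTheory.BalabanImbrieJaffe1984to88.BIJ85Eq453GaugeField (qsstarGIter0)
open LatticeWordCountBox (netDisp_le_count_true neg_count_false_le_netDisp walkEnd_castSite)
open B15Prop1GaugeLetterLocOfForestPackage (length_le_and_netDisp_of_package dist1_gaugeAct_holAtGauge_le_graded)
open B15Prop1MinimiserTowerAxialGauge (toMS_holAtGauge_eq_one isMinimizer_gaugeAct_holAtGauge_atRecord dist1_gaugeAct_holAtGauge_le_of_not_mem)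
open Summit.QuantumFields.YangMills.BalabanUVNodes.N12TowerForestRootsBj (exists_towerForest_rooted_Bj)
open Summit.QuantumFields.YangMills.BalabanUVNodes.N12GaugeLetterLocOfPlaqSmallLocal (datumLetter_of_shadows_local)
open Summit.QuantumFields.YangMills.BalabanUVNodes.N12ShadowLetterOfBox (shadowLetter_of_box)
open Summit.QuantumFields.YangMills.BalabanUVNodes.N12GaugeLetterLocNumerics (noWrap_of_levelGuard)
open Summit.QuantumFields.YangMills.BalabanUVNodes.N12WindowNearRegionGeometry (boxPlaqs_subset_plaqsOf_topSeq_pred)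
open Summit.QuantumFields.YangMills.BalabanUVNodes.N12WindowGradedLetters (rootTransporter_window stokesTerm_uniform_le)

variable {P : Params}

/-! ## §1 The window gauge with a `k`-uniform tolerance -/

/-- ★★★ **THE WINDOW GAUGE OF THE MINIMISER, `k`-UNIFORM TOLERANCE.**  Objects of one instance: torus `F.P Kt`, numerics `ν`, `1 ≤ k` with a level guard `k + c ≤ m + K` (`4d + m′ + 3 < 2L^c`: no
wrapping); a `k`-field `W` (`= ext V_k`) `ρn`-near `1` on a bond set `𝒞` (the region box) generating the (2.12) data; a minimiser `U₀` in NODE 00's class; ONE graded plaquette letter AT LEVEL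
`k − 1` — `PlaqSmallOn (plaqsOf Ω_{k−1}) (ε·η_{k−1}²) U₀` (the class ∕ [15] Thm 1 (8) one level below the window; `ε` free, Prop. 2-small); a WINDOW `X` of fine sites every point of which is
within `D₀` fine steps of `Ω_k(Z)` (`hXΩ`), with the collar numerics `hfit : D₀ + 3ℓ_k + (m′+5)L^k + ((d+4)L+2)·Σ_{l<k}Lˡ + 4 ≤ L^{k−1}·M₁`; and the REGION-BOX LETTER AT `X`.  THEN the tower-axial
gauge `σ` of the rooted forest of record carries `hu`, `σ • U₀` minimises the same data, and on every fine bond with both ends in `X`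
`‖↑((σ•U₀) b) − 1‖ ≤ ((2ℓ_k+1+m′L^k)²∕4)·(ε·η_{k−1}²) + m′·24·(((d+2)L)²∕4)·ε + m′·ρn` — a bound `≤ ((4d+m′+3)²L²∕4 + 24m′·((d+2)L)²∕4)·ε + m′·ρn` INDEPENDENT OF `k`
(`exists_windowGauge_uniform_le`).  Stokes boxes of window bonds lie in `Ω_{k−1}` (§2); the chains' members are read at the window's depth (§§3–5).
[cite: Balaban1985Variational, (2)–(4) p.278, Thm 1 (8) p.279, (16)–(18) p.280; Balaban1985RegularSpaces, (1.7) p.77, (1.19) p.79; Balaban1985Averaging, (19)–(20) p.21, Prop. 2 (52)–(53) p.26; Balaban1988Convergent, (2.2) p.255, (2.11)–(2.13) pp.256–257, (2.16) p.257; Balaban1989LargeFieldII, p.357] -/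
theorem exists_windowGauge_uniform {F : T4Family} (ν : Node00.Stage7Numerics) (Kt : ℕ) {k : ℕ} (hk0 : 0 < k) (hk : k ≤ (F.P Kt).m + (F.P Kt).K)
    (hdiv : side (F.P Kt).L ν.M₁ k ∣ (F.P Kt).sitesPerDir 0) (Z : Set (Site (F.P Kt) 0))
    -- NUMERICS: level guard (no wrapping)
    {c : ℕ} (hkc : k + c ≤ (F.P Kt).m + (F.P Kt).K) (hc : 4 * (F.P Kt).d + (3 * ((F.P Kt).d * (((F.P Kt).L - 1) / 2)) + 5) + 3 < 2 * (F.P Kt).L ^ c)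
    -- the region-normalised datum and the minimiser
    {ρn : ℝ} (hρn : 0 ≤ ρn)
    (W : GaugeField (F.P Kt) k SU2) (𝒞 : Set (PBond (F.P Kt) k)) (hD : ∀ c ∈ 𝒞, dist1 (W c) ≤ ρn)
    {U₀ : GaugeField (F.P Kt) 0 SU2}
    (hmin : IsMinimizer (Node00.avOfRecord F 2 Kt) (Node00.regMSCoPOfRecord F 2 ν Kt k (maxDomT ν.M₁ Z)) (Bj ν.M₁ Z k)
      (avgFamily (Node00.avOfRecord F 2 Kt) (qsstarGIter0 k W)) U₀)
    -- ONE graded plaquette letter at level `k − 1` ([15] Thm 1 (8) ∕ the class), FREE `ε > 0`, Prop. 2-small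
    {ε : ℝ} (hεpos : 0 < ε)
    (hUk : PlaqSmallOn (plaqsOf (Node00.topSeq (Node00.suppDomOfRecord F ν Kt (maxDomT ν.M₁ Z)) (maxDomT ν.M₁ Z) (k - 1))) (ε * (F.P Kt).eta (k - 1) ^ 2) U₀)
    (hα3 : (143 * (((((F.P Kt).d + 4 : ℕ) : ℝ)) ^ 2 / 4) ^ 2) * (ε * (F.P Kt).L ^ 2) ≤ 1 / 3)
    (hα2 : 2 * (ε * (F.P Kt).L ^ 2) ≤ 2 * deltaSU (Fin 2) / ((((F.P Kt).d + 4) * (F.P Kt).L : ℕ) : ℝ) ^ 2)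
    (haN : (((((F.P Kt).d + 2) * (F.P Kt).L : ℕ) : ℝ) ^ 2 / 4) * (2 * (ε * (F.P Kt).L ^ 2)) < deltaSU (Fin 2))
    -- THE WINDOW: within `D₀` fine steps of `Ω_k`, the collar numerics, and the region-box letter AT the window
    (X : Set (Site (F.P Kt) 0)) {D₀ : ℕ} (hXΩ : ∀ x ∈ X, ∃ x₀ ∈ maxDomT ν.M₁ Z k, ∃ w₀ : List (Letter (F.P Kt).d), w₀.length ≤ D₀ ∧ walkEnd x₀ w₀ = x)
    (hfit : D₀ + 3 * (∑ i ∈ Finset.range (k + 1), ((F.P Kt).d * (((F.P Kt).L ^ i - 1) / 2) + 1)) + ((3 * ((F.P Kt).d * (((F.P Kt).L - 1) / 2)) + 5) + 5) * (F.P Kt).L ^ k +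
      (((F.P Kt).d + 4) * (F.P Kt).L + 2) * (∑ l ∈ Finset.Ico 0 k, (F.P Kt).L ^ l) + 4 ≤ (F.P Kt).L ^ (k - 1) * ν.M₁)
    (hBox : ∀ x ∈ X, ∀ w : List (Letter (F.P Kt).d), w.length ≤ (∑ i ∈ Finset.range (k + 1), ((F.P Kt).d * (((F.P Kt).L ^ i - 1) / 2) + 1)) + (3 * ((F.P Kt).d * (((F.P Kt).L - 1) / 2)) + 5) * (F.P Kt).L ^ k + (F.P Kt).L ^ k →
      ∀ μ : Fin (F.P Kt).d, (⟨blockIter k (walkEnd x w), μ⟩ : PBond (F.P Kt) k) ∈ 𝒞) :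
    ∃ σ : GaugeTransf (F.P Kt) 0 SU2,
      (∀ j, j ≤ k → ∀ b ∈ bondsOf (Bj ν.M₁ Z k j), toMS σ j b.src = 1 ∧ toMS σ j b.tgt = 1) ∧
      IsMinimizer (Node00.avOfRecord F 2 Kt) (Node00.regMSCoPOfRecord F 2 ν Kt k (maxDomT ν.M₁ Z)) (Bj ν.M₁ Z k)
        (avgFamily (Node00.avOfRecord F 2 Kt) (qsstarGIter0 k W)) (gaugeAct σ U₀) ∧
      ∀ b : PBond (F.P Kt) 0, b.src ∈ X → b.tgt ∈ X →
        ‖((gaugeAct σ U₀ b : SU2) : Matrix (Fin 2) (Fin 2) ℂ) - 1‖ ≤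
          (((2 * (∑ i ∈ Finset.range (k + 1), ((F.P Kt).d * (((F.P Kt).L ^ i - 1) / 2) + 1)) + 1 + (3 * ((F.P Kt).d * (((F.P Kt).L - 1) / 2)) + 5) * (F.P Kt).L ^ k : ℕ) : ℝ)) ^ 2 / 4 * (ε * (F.P Kt).eta (k - 1) ^ 2) +
            ((3 * ((F.P Kt).d * (((F.P Kt).L - 1) / 2)) + 5 : ℕ) : ℝ) * (24 * ((((((F.P Kt).d + 2) * (F.P Kt).L : ℕ) : ℝ) ^ 2 / 4) * ε)) + ((3 * ((F.P Kt).d * (((F.P Kt).L - 1) / 2)) + 5 : ℕ) : ℝ) * ρn := by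
  classical
  have hk1 : 1 ≤ k := hk0
  have hL2 : 2 ≤ (F.P Kt).L := (F.P Kt).hL.2
  have hLk : 1 ≤ (F.P Kt).L ^ k := Nat.one_le_pow _ _ (F.P Kt).L_pos
  have hsplit : ((3 * ((F.P Kt).d * (((F.P Kt).L - 1) / 2)) + 5) + 5) * (F.P Kt).L ^ k =
      (3 * ((F.P Kt).d * (((F.P Kt).L - 1) / 2)) + 5) * (F.P Kt).L ^ k + 5 * (F.P Kt).L ^ k := add_mul _ _ _
  have hM2 : 2 ≤ ν.M₁ := by
    by_contra hlt
    have hle : ν.M₁ ≤ 1 := by omega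
    have h1 : (F.P Kt).L ^ (k - 1) * ν.M₁ ≤ (F.P Kt).L ^ k := by
      calc (F.P Kt).L ^ (k - 1) * ν.M₁ ≤ (F.P Kt).L ^ (k - 1) * 1 := Nat.mul_le_mul_left _ hle
        _ ≤ (F.P Kt).L ^ k := by rw [mul_one]; exact Nat.pow_le_pow_right (F.P Kt).L_pos (Nat.sub_le k 1)
    have h2 := hfit.trans h1
    omega
  have hM : 1 ≤ ν.M₁ := by omega
  have hN := noWrap_of_levelGuard (P := F.P Kt) hkc hc
  have hεP : 0 ≤ ε * (F.P Kt).eta (k - 1) ^ 2 := by unfold Params.eta; positivity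
  have hm0 : (0 : ℝ) ≤ ((3 * ((F.P Kt).d * (((F.P Kt).L - 1) / 2)) + 5 : ℕ) : ℝ) := Nat.cast_nonneg _
  have hΘ0 : 0 ≤ 24 * ((((((F.P Kt).d + 2) * (F.P Kt).L : ℕ) : ℝ) ^ 2 / 4) * ε) := by positivity
  -- ### the rooted tower forest of `𝐁_k(Z)` (p635000), uniform budgets
  obtain ⟨path, root, -, hF2, -, -, hw, hlevel, hcov, hcentre⟩ :=
    exists_towerForest_rooted_Bj (P := F.P Kt) (M₁ := ν.M₁) (Z := Z) hk hk1 hM2 hdiv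
  have hJ : ∀ x : Site (F.P Kt) 0, Classical.choose (hcov x) ≤ k ∧ iterBlockOf (Classical.choose (hcov x)) x ∈ (Bj ν.M₁ Z k : DetSet (F.P Kt)) (Classical.choose (hcov x)) :=
    fun x => Classical.choose_spec (hcov x)
  set X₁ : Set (Site (F.P Kt) 0) := {x | x ∈ X ∧ x ∈ maxDomT ν.M₁ Z 1} with hX₁_def
  have hℓs : ∀ x ∈ X₁, (path x).length ≤ (fun _ : Site (F.P Kt) 0 => (∑ i ∈ Finset.range (k + 1), ((F.P Kt).d * (((F.P Kt).L ^ i - 1) / 2) + 1))) x :=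
    fun x _ => (length_le_and_netDisp_of_package ν.M₁ Z k path root hlevel hcov x).1
  have hdisp : ∀ x ∈ X₁, ∀ ν', netDisp ((path x).map fun s => (s.bond.dir, s.fwd)) ν' = ((x ν').val : ℤ) - ((root x ν').val : ℤ) :=
    fun x _ => (length_le_and_netDisp_of_package ν.M₁ Z k path root hlevel hcov x).2
  have hcapS : ∀ x ∈ X₁, (fun _ : Site (F.P Kt) 0 => (∑ i ∈ Finset.range (k + 1), ((F.P Kt).d * (((F.P Kt).L ^ i - 1) / 2) + 1))) x ≤ (∑ i ∈ Finset.range (k + 1), ((F.P Kt).d * (((F.P Kt).L ^ i - 1) / 2) + 1)) := fun _ _ => le_rfl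
  have hcapB : ∀ b : PBond (F.P Kt) 0, b.src ∈ X₁ → b.tgt ∈ X₁ → (fun _ : PBond (F.P Kt) 0 => (3 * ((F.P Kt).d * (((F.P Kt).L - 1) / 2)) + 5) * (F.P Kt).L ^ k) b ≤ (3 * ((F.P Kt).d * (((F.P Kt).L - 1) / 2)) + 5) * (F.P Kt).L ^ k :=
    fun _ _ _ => le_rfl
  -- ### the datum letter AT THE WINDOW, then relative to the roots
  have hGmem := shadowLetter_of_box (𝔹 := (Bj ν.M₁ Z k : DetSet (F.P Kt))) X ((∑ i ∈ Finset.range (k + 1), ((F.P Kt).d * (((F.P Kt).L ^ i - 1) / 2) + 1)) + (3 * ((F.P Kt).d * (((F.P Kt).L - 1) / 2)) + 5) * (F.P Kt).L ^ k) 𝒞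
    (fun i hi => Nat.pow_le_pow_right (F.P Kt).L_pos hi) hBox
  have hWjX := datumLetter_of_shadows_local Kt hk (Bj ν.M₁ Z k) W hρn hD X _ hGmem
  have hroot : ∀ x : Site (F.P Kt) 0, walkEnd x (wordRev ((path x).map fun s => (s.bond.dir, s.fwd))) = root x := fun x => by
    have e := walkEnd_walkEnd_wordRev (root x) ((path x).map fun s => (s.bond.dir, s.fwd))
    rwa [(hw x).2.2] at e
  have hlenRev : ∀ x : Site (F.P Kt) 0, (wordRev ((path x).map fun s => (s.bond.dir, s.fwd))).length = (path x).length := fun x => by simp [wordRev]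
  have hWjR : ∀ x ∈ X₁, ∀ i ≤ k, ∀ c ∈ bondsOf ((Bj ν.M₁ Z k : DetSet (F.P Kt)) i),
      (∃ w : List (Letter (F.P Kt).d), w.length ≤ (3 * ((F.P Kt).d * (((F.P Kt).L - 1) / 2)) + 5) * (F.P Kt).L ^ k ∧ (walkEnd (root x) w = embIter i c.src ∨ walkEnd (root x) w = embIter i c.tgt)) →
      dist1 (avgFamily (Node00.avOfRecord F 2 Kt) (qsstarGIter0 k W) i c) ≤ ρn := by
    intro x hx i hi c hc hw'
    obtain ⟨w, hwl, hwe⟩ := hw'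
    refine hWjX x hx.1 i hi c hc ⟨wordRev ((path x).map fun s => (s.bond.dir, s.fwd)) ++ w, ?_, ?_⟩
    · rw [List.length_append, hlenRev]
      exact add_le_add (hℓs x hx) hwl
    · rw [walkEnd_append, hroot]; exact hwe
  -- ### the root-transporter letter on the bonds of the window (§5), `k`-uniform
  have hfitT : D₀ + ((∑ i ∈ Finset.range (k + 1), ((F.P Kt).d * (((F.P Kt).L ^ i - 1) / 2) + 1)) + (3 * ((F.P Kt).d * (((F.P Kt).L - 1) / 2)) + 5) * (F.P Kt).L ^ k + (F.P Kt).L ^ k) +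
      (F.P Kt).L ^ k + (3 * (F.P Kt).L ^ k + (((F.P Kt).d + 4) * (F.P Kt).L + 2) * ∑ l ∈ Finset.Ico 0 k, (F.P Kt).L ^ l) + 1 ≤ (F.P Kt).L ^ (k - 1) * ν.M₁ := by
    have h := hfit; omega
  have hT : ∀ b : PBond (F.P Kt) 0, b.src ∈ X₁ → b.tgt ∈ X₁ → root b.src ≠ root b.tgt →
      ∃ (Ωw : List (Letter (F.P Kt).d)) (g : SU2), walkEnd (root b.src) Ωw = root b.tgt ∧ Ωw.length ≤ (fun _ : PBond (F.P Kt) 0 => (3 * ((F.P Kt).d * (((F.P Kt).L - 1) / 2)) + 5) * (F.P Kt).L ^ k) b ∧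
        dist1 (holAt U₀ (walk (root b.src) Ωw) * g⁻¹) ≤ ((3 * ((F.P Kt).d * (((F.P Kt).L - 1) / 2)) + 5 : ℕ) : ℝ) * (24 * ((((((F.P Kt).d + 2) * (F.P Kt).L : ℕ) : ℝ) ^ 2 / 4) * ε)) ∧
        dist1 g ≤ ((3 * ((F.P Kt).d * (((F.P Kt).L - 1) / 2)) + 5 : ℕ) : ℝ) * ρn := by
    intro b hbs hbt _
    obtain ⟨Ωw, g, hwe, hl, hH, hg⟩ := rootTransporter_window ν Kt hk1 hk hM2 hdiv Z root hcentre W hmin hεpos hUk hα3 hα2 haN X hXΩ hfitT hρn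
      b hbs.1 hbs.2 hbt.2 (wr := wordRev ((path b.src).map fun s => (s.bond.dir, s.fwd))) (by rw [hlenRev]; exact hℓs b.src hbs) (hroot b.src)
      (hWjR b.src hbs) (hJ b.src).2
    exact ⟨Ωw, g, hwe, hl.trans (Nat.mul_le_mul_left _ (Nat.pow_le_pow_right (F.P Kt).L_pos (min_le_right _ _))), hH, hg⟩
  -- ### the Stokes boxes of the window bonds lie one level below the window (§2)
  have hSΩ : ∀ b : PBond (F.P Kt) 0, b.src ∈ X₁ → b.tgt ∈ X₁ →
      (boxPlaqs (fun κ => ((b.src κ).val : ℤ) - (((2 * max ((fun _ : Site (F.P Kt) 0 => (∑ i ∈ Finset.range (k + 1), ((F.P Kt).d * (((F.P Kt).L ^ i - 1) / 2) + 1))) b.src) ((fun _ : Site (F.P Kt) 0 => (∑ i ∈ Finset.range (k + 1), ((F.P Kt).d * (((F.P Kt).L ^ i - 1) / 2) + 1))) b.tgt) + 1 +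
            (fun _ : PBond (F.P Kt) 0 => (3 * ((F.P Kt).d * (((F.P Kt).L - 1) / 2)) + 5) * (F.P Kt).L ^ k) b) + (fun _ : Site (F.P Kt) 0 => (∑ i ∈ Finset.range (k + 1), ((F.P Kt).d * (((F.P Kt).L ^ i - 1) / 2) + 1))) b.src : ℕ) : ℤ))
          (fun κ => ((b.src κ).val : ℤ) + (((2 * max ((fun _ : Site (F.P Kt) 0 => (∑ i ∈ Finset.range (k + 1), ((F.P Kt).d * (((F.P Kt).L ^ i - 1) / 2) + 1))) b.src) ((fun _ : Site (F.P Kt) 0 => (∑ i ∈ Finset.range (k + 1), ((F.P Kt).d * (((F.P Kt).L ^ i - 1) / 2) + 1))) b.tgt) + 1 +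
            (fun _ : PBond (F.P Kt) 0 => (3 * ((F.P Kt).d * (((F.P Kt).L - 1) / 2)) + 5) * (F.P Kt).L ^ k) b) + (fun _ : Site (F.P Kt) 0 => (∑ i ∈ Finset.range (k + 1), ((F.P Kt).d * (((F.P Kt).L ^ i - 1) / 2) + 1))) b.src : ℕ) : ℤ) + 2) : Set (Plaq (F.P Kt) 0)) ⊆
        plaqsOf (Node00.topSeq (Node00.suppDomOfRecord F ν Kt (maxDomT ν.M₁ Z)) (maxDomT ν.M₁ Z) (k - 1)) := by
    intro b hbs _
    obtain ⟨x₀, hx₀, w₀, hw₀l, hw₀e⟩ := hXΩ b.src hbs.1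
    simp only [max_self]
    refine boxPlaqs_subset_plaqsOf_topSeq_pred ν Kt hk1 le_rfl hM hdiv Z hx₀ hw₀e hw₀l ?_
    have h := hfit
    have hsum0 : 0 ≤ (((F.P Kt).d + 4) * (F.P Kt).L + 2) * ∑ l ∈ Finset.Ico 0 k, (F.P Kt).L ^ l := Nat.zero_le _
    omega
  -- ### the tolerance dominates `ρn` (the pinned bonds)
  have hρTOL : ρn ≤ (((2 * (∑ i ∈ Finset.range (k + 1), ((F.P Kt).d * (((F.P Kt).L ^ i - 1) / 2) + 1)) + 1 + (3 * ((F.P Kt).d * (((F.P Kt).L - 1) / 2)) + 5) * (F.P Kt).L ^ k : ℕ) : ℝ)) ^ 2 / 4 * (ε * (F.P Kt).eta (k - 1) ^ 2) +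
            ((3 * ((F.P Kt).d * (((F.P Kt).L - 1) / 2)) + 5 : ℕ) : ℝ) * (24 * ((((((F.P Kt).d + 2) * (F.P Kt).L : ℕ) : ℝ) ^ 2 / 4) * ε)) + ((3 * ((F.P Kt).d * (((F.P Kt).L - 1) / 2)) + 5 : ℕ) : ℝ) * ρn := by
    have h1 : (0 : ℝ) ≤ (((2 * (∑ i ∈ Finset.range (k + 1), ((F.P Kt).d * (((F.P Kt).L ^ i - 1) / 2) + 1)) + 1 + (3 * ((F.P Kt).d * (((F.P Kt).L - 1) / 2)) + 5) * (F.P Kt).L ^ k : ℕ) : ℝ)) ^ 2 / 4 * (ε * (F.P Kt).eta (k - 1) ^ 2) :=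
      mul_nonneg (div_nonneg (sq_nonneg _) (by norm_num)) hεP
    have h2 : (0 : ℝ) ≤ ((3 * ((F.P Kt).d * (((F.P Kt).L - 1) / 2)) + 5 : ℕ) : ℝ) * (24 * ((((((F.P Kt).d + 2) * (F.P Kt).L : ℕ) : ℝ) ^ 2 / 4) * ε)) := mul_nonneg hm0 hΘ0
    have hm1 : (1 : ℝ) ≤ ((3 * ((F.P Kt).d * (((F.P Kt).L - 1) / 2)) + 5 : ℕ) : ℝ) := Nat.one_le_cast.2 (by omega)
    nlinarith
  -- ### assemble: the tower-axial gauge; window bonds inside `Ω₁(Z)` by the interior letter at `X₁`, window bonds meeting `Γ₀` pinned to the datum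
  refine ⟨fun x => holAt U₀ (path x), toMS_holAtGauge_eq_one path U₀ (Bj ν.M₁ Z k) k hF2,
    isMinimizer_gaugeAct_holAtGauge_atRecord ν Kt hk Z path U₀ hF2 hmin, fun b hbs hbt => ?_⟩
  by_cases hin : b.src ∈ maxDomT ν.M₁ Z 1 ∧ b.tgt ∈ maxDomT ν.M₁ Z 1
  · exact dist1_gaugeAct_holAtGauge_le_graded U₀ path root (fun x => ⟨(hw x).2.1, (hw x).2.2⟩) X₁ (fun _ => (∑ i ∈ Finset.range (k + 1), ((F.P Kt).d * (((F.P Kt).L ^ i - 1) / 2) + 1))) hℓs hdisp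
      (fun _ => (3 * ((F.P Kt).d * (((F.P Kt).L - 1) / 2)) + 5) * (F.P Kt).L ^ k) hcapS hcapB hN hεP hUk hSΩ (mul_nonneg hm0 hΘ0) (mul_nonneg hm0 hρn) hT ⟨hbs, hin.1⟩ ⟨hbt, hin.2⟩
  · have hb' : b.src ∉ maxDomT ν.M₁ Z 1 ∨ b.tgt ∉ maxDomT ν.M₁ Z 1 := not_and_or.mp hin
    have hsh : (⟨blockIter k b.src, b.dir⟩ : PBond (F.P Kt) k) ∈ 𝒞 := hBox b.src hbs [] (by simp) b.dir
    have h := dist1_gaugeAct_holAtGauge_le_of_not_mem (Node00.avOfRecord F 2 Kt) _ ν.M₁ Z hk0 hk path hF2 W hmin hρn hb' (fun _ => hD _ hsh)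
    exact h.trans hρTOL

/-- ★★★ **THE WINDOW GAUGE, `k`-FREE CONSTANT**: `exists_windowGauge_uniform` with its tolerance dominated by `((4d+m′+3)²·L²∕4 + 24·m′·((d+2)L)²∕4)·ε + m′·ρn` — no `k` left in the letter.
[cite: Balaban1985Variational, (2)–(4) p.278, Thm 1 (8) p.279, (16)–(18) p.280; Balaban1985Averaging, Prop. 2 (52)–(53) p.26; Balaban1988Convergent, (2.12)–(2.13) pp.256–257, (2.16) p.257; Balaban1989LargeFieldII, p.357] -/
theorem exists_windowGauge_uniform_le {F : T4Family} (ν : Node00.Stage7Numerics) (Kt : ℕ) {k : ℕ} (hk0 : 0 < k) (hk : k ≤ (F.P Kt).m + (F.P Kt).K)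
    (hdiv : side (F.P Kt).L ν.M₁ k ∣ (F.P Kt).sitesPerDir 0) (Z : Set (Site (F.P Kt) 0))
    {c : ℕ} (hkc : k + c ≤ (F.P Kt).m + (F.P Kt).K) (hc : 4 * (F.P Kt).d + (3 * ((F.P Kt).d * (((F.P Kt).L - 1) / 2)) + 5) + 3 < 2 * (F.P Kt).L ^ c)
    {ρn : ℝ} (hρn : 0 ≤ ρn)
    (W : GaugeField (F.P Kt) k SU2) (𝒞 : Set (PBond (F.P Kt) k)) (hD : ∀ c ∈ 𝒞, dist1 (W c) ≤ ρn)
    {U₀ : GaugeField (F.P Kt) 0 SU2}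
    (hmin : IsMinimizer (Node00.avOfRecord F 2 Kt) (Node00.regMSCoPOfRecord F 2 ν Kt k (maxDomT ν.M₁ Z)) (Bj ν.M₁ Z k)
      (avgFamily (Node00.avOfRecord F 2 Kt) (qsstarGIter0 k W)) U₀)
    {ε : ℝ} (hεpos : 0 < ε)
    (hUk : PlaqSmallOn (plaqsOf (Node00.topSeq (Node00.suppDomOfRecord F ν Kt (maxDomT ν.M₁ Z)) (maxDomT ν.M₁ Z) (k - 1))) (ε * (F.P Kt).eta (k - 1) ^ 2) U₀)
    (hα3 : (143 * (((((F.P Kt).d + 4 : ℕ) : ℝ)) ^ 2 / 4) ^ 2) * (ε * (F.P Kt).L ^ 2) ≤ 1 / 3)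
    (hα2 : 2 * (ε * (F.P Kt).L ^ 2) ≤ 2 * deltaSU (Fin 2) / ((((F.P Kt).d + 4) * (F.P Kt).L : ℕ) : ℝ) ^ 2)
    (haN : (((((F.P Kt).d + 2) * (F.P Kt).L : ℕ) : ℝ) ^ 2 / 4) * (2 * (ε * (F.P Kt).L ^ 2)) < deltaSU (Fin 2))
    (X : Set (Site (F.P Kt) 0)) {D₀ : ℕ} (hXΩ : ∀ x ∈ X, ∃ x₀ ∈ maxDomT ν.M₁ Z k, ∃ w₀ : List (Letter (F.P Kt).d), w₀.length ≤ D₀ ∧ walkEnd x₀ w₀ = x)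
    (hfit : D₀ + 3 * (∑ i ∈ Finset.range (k + 1), ((F.P Kt).d * (((F.P Kt).L ^ i - 1) / 2) + 1)) + ((3 * ((F.P Kt).d * (((F.P Kt).L - 1) / 2)) + 5) + 5) * (F.P Kt).L ^ k +
      (((F.P Kt).d + 4) * (F.P Kt).L + 2) * (∑ l ∈ Finset.Ico 0 k, (F.P Kt).L ^ l) + 4 ≤ (F.P Kt).L ^ (k - 1) * ν.M₁)
    (hBox : ∀ x ∈ X, ∀ w : List (Letter (F.P Kt).d), w.length ≤ (∑ i ∈ Finset.range (k + 1), ((F.P Kt).d * (((F.P Kt).L ^ i - 1) / 2) + 1)) + (3 * ((F.P Kt).d * (((F.P Kt).L - 1) / 2)) + 5) * (F.P Kt).L ^ k + (F.P Kt).L ^ k →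
      ∀ μ : Fin (F.P Kt).d, (⟨blockIter k (walkEnd x w), μ⟩ : PBond (F.P Kt) k) ∈ 𝒞) :
    ∃ σ : GaugeTransf (F.P Kt) 0 SU2,
      (∀ j, j ≤ k → ∀ b ∈ bondsOf (Bj ν.M₁ Z k j), toMS σ j b.src = 1 ∧ toMS σ j b.tgt = 1) ∧
      IsMinimizer (Node00.avOfRecord F 2 Kt) (Node00.regMSCoPOfRecord F 2 ν Kt k (maxDomT ν.M₁ Z)) (Bj ν.M₁ Z k)
        (avgFamily (Node00.avOfRecord F 2 Kt) (qsstarGIter0 k W)) (gaugeAct σ U₀) ∧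
      ∀ b : PBond (F.P Kt) 0, b.src ∈ X → b.tgt ∈ X →
        ‖((gaugeAct σ U₀ b : SU2) : Matrix (Fin 2) (Fin 2) ℂ) - 1‖ ≤
          ((((4 * (F.P Kt).d + (3 * ((F.P Kt).d * (((F.P Kt).L - 1) / 2)) + 5) + 3 : ℕ) : ℝ)) ^ 2 * ((F.P Kt).L : ℝ) ^ 2 / 4 + ((3 * ((F.P Kt).d * (((F.P Kt).L - 1) / 2)) + 5 : ℕ) : ℝ) * (24 * (((((F.P Kt).d + 2) * (F.P Kt).L : ℕ) : ℝ) ^ 2 / 4))) * ε + ((3 * ((F.P Kt).d * (((F.P Kt).L - 1) / 2)) + 5 : ℕ) : ℝ) * ρn := by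
  obtain ⟨σ, hu, hminσ, hb⟩ := exists_windowGauge_uniform ν Kt hk0 hk hdiv Z hkc hc hρn W 𝒞 hD hmin hεpos hUk hα3 hα2 haN X hXΩ hfit hBox
  refine ⟨σ, hu, hminσ, fun b hbs hbt => (hb b hbs hbt).trans ?_⟩
  have h1 := stokesTerm_uniform_le (P := F.P Kt) (F.P Kt).hL.2 (show 1 ≤ k from hk0) hεpos.le
  have h2 : ((3 * ((F.P Kt).d * (((F.P Kt).L - 1) / 2)) + 5 : ℕ) : ℝ) * (24 * ((((((F.P Kt).d + 2) * (F.P Kt).L : ℕ) : ℝ) ^ 2 / 4) * ε)) = ((3 * ((F.P Kt).d * (((F.P Kt).L - 1) / 2)) + 5 : ℕ) : ℝ) * (24 * (((((F.P Kt).d + 2) * (F.P Kt).L : ℕ) : ℝ) ^ 2 / 4)) * ε := by ring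
  rw [h2]
  linarith

end Summit.QuantumFields.YangMills.BalabanUVNodes.N12WindowGaugeLetterUniform

end
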